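import Mathlib
import HarnessLib
import Summits.RiemannHypothesis.RiemannHypothesis.Theses.NbSectionTwoDyadic
import Summits.RiemannHypothesis.RiemannHypothesis.Theorems.NbSectionTwoDyadicDyadicPrimalResidual
import Summits.RiemannHypothesis.RiemannHypothesis.Theorems.NbSectionTwoDyadicDyadicDualCertificate
import Summits.RiemannHypothesis.RiemannHypothesis.Theorems.NbSectionTwoDyadicPoissonKernelFourier
import Summits.RiemannHypothesis.RiemannHypothesis.Theorems.NbSectionTwoDyadicAssembly

/-!
# RiemannHypothesis / NbSectionTwoDyadic — the TARGET `SectionTwoDyadicLaw` (exact dyadic law of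
the 2-section)

Route `NbSectionTwoDyadic`, target item `SectionTwoDyadicLaw` (stmt-RiemannHypothesis-22780): for
every `K`, the truncated Nyman–Beurling (Báez-Duarte) distance of the 2-section `ζ_2 = 1 + 2^{-s}` at
mollifier length `N = 2^K`,

  `inf_a ∫ |1 − ζ_2(1/2+it) Σ_{n<2^K} a_n (n+1)^{-(1/2+it)}|² dt/(1/4+t²) = 2π / (18·2^K − 8)`,

is ATTAINED (by the dyadic vector `a_{2^i − 1} = (−1)^i 6(3·2^K − 2^{i+1})/(18·2^K − 8)`) and is a
lower bound for every complex `a`.  This file is the route's deciding theorem `closes` applied to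
the four landed items: `PoissonKernelFourier_proof` (22783), `DyadicPrimalResidual_proof` (22782),
`DyadicDualCertificate_proof` (22781), `Assembly_proof` (22784).

RH-free: an exactly solved TOY (the 2-section has no zeros off `Re s = 0`); RECORD class, 0 summit
credit. No summit is proved by this file; nothing here bears on the truth of RH.
-/

noncomputable section

-- D-0017: `Summit.<S>.<S>.…` is the designed namespace of a single-problem summit.
set_option linter.dupNamespace false

namespace Summit.RiemannHypothesis.RiemannHypothesis.Theorems.NbSectionTwo

/-- **Target `SectionTwoDyadicLaw`** (item stmt-RiemannHypothesis-22780) of route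
`NbSectionTwoDyadic`: the exact dyadic law `min = 2π/(18·2^K − 8)` of the 2-section, attained, for
every `K` — by the route's glue `closes` from the four proved items. RH-free; no summit is proved by
this. -/
theorem SectionTwoDyadicLaw_proof :
    Summit.RiemannHypothesis.RiemannHypothesis.Theses.NbSectionTwoDyadic.SectionTwoDyadicLaw :=
  Summit.RiemannHypothesis.RiemannHypothesis.Theses.NbSectionTwoDyadic.closes
    PoissonKernelFourier_proof DyadicPrimalResidual_proof DyadicDualCertificate_proof Assembly_proof

end Summit.RiemannHypothesis.RiemannHypothesis.Theorems.NbSectionTwo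

end
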